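import Summits.Ventures.PercRepro.S1CoreCapSevenTwo

/-!
# PercRepro — TOWARDS `Q*(7) = 19`: THE FAT COUNTING LEMMA WITH CHORDS (p1, gen 26)

The fat counting lemma of S1CoreCapSevenThin for families of 3-point lines over `P₀` in which a line may have TWO
points on `P₀` (a CHORD, with one hub off `P₀`), provided at most one chord passes through each point off `P₀`
(`two_mul_sum_newFat_le'`): the lines through a point `v ∉ P₀` still form a free sequence when the chord through
`v` (if any) is placed first — the thin lines through `v` keep a second point off `P₀` and off the chord — and
the lines through a point of `P₀` form one as well, each owning a point off `P₀` (`freeCountR_eq_length_of_off`);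
the star's new fat points other than `v` lie on one star line each and the lines avoiding `v` have budget
`b − 1 − [v fat]` exactly as before. Hence `two_mul_sum_cap_chord_le`: `2 · Σ cap ≤ b (b + 1) + 2 · fat P₀ · b`.
Used by S1CoreCapSevenTwoNon (two big lines in no plane: non-coplanarity means one chord per hub).
`proofs/P1-S4-CAPBRIDGE.md` §18 (B). Axioms: standard.
-/

namespace PercRepro

namespace S1

namespace FourCap

namespace Seven

variable {β : Type} [DecidableEq β]

/-- **A list of lines each owning a point off `P₀` and off the other lines is a free sequence.** -/
theorem freeCountR_eq_length_of_off (P₀ : Finset β) :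
    ∀ l : List (Finset β), l.Nodup →
      (∀ L ∈ l, ∃ x ∈ L, x ∉ P₀ ∧ ∀ L' ∈ l, L' ≠ L → x ∉ L') → freeCountR P₀ l = l.length
  | [], _, _ => rfl
  | L :: l, hnd, hall => by
    have ih := freeCountR_eq_length_of_off P₀ l (List.nodup_cons.1 hnd).2 (fun L' hL' => by
      obtain ⟨x, hx, hxP, hxl⟩ := hall L' (List.mem_cons_of_mem _ hL')
      exact ⟨x, hx, hxP, fun L'' hL'' hne => hxl L'' (List.mem_cons_of_mem _ hL'') hne⟩)
    obtain ⟨x, hx, hxP, hxl⟩ := hall L List.mem_cons_self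
    rw [freeCountR_cons_of_new hx hxP (fun L' hL' => hxl L' (List.mem_cons_of_mem _ hL')
      (fun h => (List.nodup_cons.1 hnd).1 (h ▸ hL'))), ih]
    rfl

/-- **The fat counting lemma with chords**: a family of 3-point lines over `P₀`, each with at most two points on
`P₀`, pairwise sharing at most one point, with at most one line with two points on `P₀` through each point off
`P₀`, and budget `b` on free lines and new fat points, has `2 · Σ_{L ∈ T} (1 + fat (L ∖ P₀)) ≤ b (b + 1)`. -/
theorem two_mul_sum_newFat_le' (w : β → ℕ) (P₀ : Finset β) :
    ∀ (n b : ℕ), b ≤ n → ∀ T : Finset (Finset β), (∀ L ∈ T, L.card = 3 ∧ (L ∩ P₀).card ≤ 2) →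
      (∀ L ∈ T, ∀ L' ∈ T, L ≠ L' → (L ∩ L').card ≤ 1) →
      (∀ v, v ∉ P₀ → ∀ L ∈ T, ∀ L' ∈ T, v ∈ L → v ∈ L' → (L ∩ P₀).card = 2 → (L' ∩ P₀).card = 2 → L = L') →
      (∀ l : List (Finset β), l.Nodup → (∀ L ∈ l, L ∈ T) →
        freeCountR P₀ l + fat w (unionLR P₀ l \ P₀) ≤ b) →
      2 * ∑ L ∈ T, (1 + fat w (L \ P₀)) ≤ b * (b + 1)
  | 0, b, hb, T, hT, _, _, hk => by
    have hb0 : b = 0 := by omega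
    subst hb0
    rcases Finset.eq_empty_or_nonempty T with hempty | ⟨L, hL⟩
    · subst hempty; simp
    · exfalso
      have h := hk [L] (List.nodup_singleton L) (by simpa using hL)
      obtain ⟨hL3, hLP⟩ := hT L hL
      have hsd : 0 < (L \ P₀).card := by
        have := Finset.card_sdiff_add_card_inter L P₀
        omega
      obtain ⟨x, hx⟩ := Finset.card_pos.1 hsd
      rw [freeCountR_cons_of_new (Finset.mem_sdiff.1 hx).1 (Finset.mem_sdiff.1 hx).2 (by simp)] at h
      simp [freeCountR] at h
  | n + 1, b, hb, T, hT, hpair, hone, hk => by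
    by_cases hbn : b ≤ n
    · exact two_mul_sum_newFat_le' w P₀ n b hbn T hT hpair hone hk
    have hbe : b = n + 1 := by omega
    rcases Finset.eq_empty_or_nonempty T with hempty | ⟨L₀, hL₀⟩
    · subst hempty; simp
    obtain ⟨hL3, hLP⟩ := hT L₀ hL₀
    have hsd : 0 < (L₀ \ P₀).card := by
      have := Finset.card_sdiff_add_card_inter L₀ P₀
      omega
    obtain ⟨v, hv⟩ := Finset.card_pos.1 hsd
    have hvL : v ∈ L₀ := (Finset.mem_sdiff.1 hv).1
    have hvP : v ∉ P₀ := (Finset.mem_sdiff.1 hv).2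
    set e := (if w v = 2 then 1 else 0) with he
    have he1 : e ≤ 1 := by rw [he]; split_ifs <;> omega
    -- the star of `v`
    set A := T.filter (fun L => v ∈ L) with hA
    have hAmem : ∀ L ∈ A, L ∈ T ∧ v ∈ L := fun L hL => Finset.mem_filter.1 hL
    have hL₀A : L₀ ∈ A := Finset.mem_filter.2 ⟨hL₀, hvL⟩
    have hApair : ∀ L ∈ A, ∀ L' ∈ A, L ≠ L' → (L ∩ L').card ≤ 1 :=
      fun L hL L' hL' hne => hpair L (hAmem L hL).1 L' (hAmem L' hL').1 hne
    -- the star as a list: the thin lines, then (at the tail, placed first) the chord if any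
    set At := A.filter (fun L => (L ∩ P₀).card ≤ 1) with hAt
    set Ac := A.filter (fun L => ¬ (L ∩ P₀).card ≤ 1) with hAc
    have hAc1 : Ac.card ≤ 1 := by
      rw [Finset.card_le_one]
      intro L hL L' hL'
      have h1 := Finset.mem_filter.1 hL
      have h2 := Finset.mem_filter.1 hL'
      have c1 : (L ∩ P₀).card = 2 := by have := (hT L (hAmem L h1.1).1).2; omega
      have c2 : (L' ∩ P₀).card = 2 := by have := (hT L' (hAmem L' h2.1).1).2; omega
      exact hone v hvP L (hAmem L h1.1).1 L' (hAmem L' h2.1).1 (hAmem L h1.1).2 (hAmem L' h2.1).2 c1 c2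
    set a := At.toList ++ Ac.toList with ha
    have hamem : ∀ L, L ∈ a ↔ L ∈ A := by
      intro L
      simp only [ha, List.mem_append, Finset.mem_toList, hAt, hAc, Finset.mem_filter]
      tauto
    have hand : a.Nodup := by
      rw [ha, List.nodup_append']
      refine ⟨Finset.nodup_toList _, Finset.nodup_toList _, fun L hL hL' => ?_⟩
      have h1 := Finset.mem_filter.1 (Finset.mem_toList.1 hL)
      have h2 := Finset.mem_filter.1 (Finset.mem_toList.1 hL')
      exact h2.2 h1.2
    -- the chord part is free, the thin part is free over it
    have hfreec : freeCountR P₀ Ac.toList = Ac.toList.length := by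
      rcases Nat.le_one_iff_eq_zero_or_eq_one.1 hAc1 with h0 | h1
      · rw [Finset.card_eq_zero.1 h0, Finset.toList_empty]; rfl
      · obtain ⟨C, hC⟩ := Finset.card_eq_one.1 h1
        rw [hC, Finset.toList_singleton]
        have hCA : C ∈ A := (Finset.mem_filter.1 (hC ▸ Finset.mem_singleton_self C)).1
        rw [freeCountR_cons_of_new (hAmem C hCA).2 hvP (by simp)]
        rfl
    have hfreet : freeCountR (unionLR P₀ Ac.toList) At.toList = At.toList.length := by
      refine freeCountR_eq_length_of_off _ At.toList (Finset.nodup_toList _) (fun L hL => ?_)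
      have hLt := Finset.mem_filter.1 (Finset.mem_toList.1 hL)
      have hLA := hAmem L hLt.1
      -- a second point of `L` off `P₀`
      have hsd2 : 1 < (L \ P₀).card := by
        have := Finset.card_sdiff_add_card_inter L P₀
        have := (hT L hLA.1).1
        omega
      obtain ⟨x, hx, hxv⟩ := Finset.exists_mem_ne hsd2 v
      have hxL : x ∈ L := (Finset.mem_sdiff.1 hx).1
      have hxP : x ∉ P₀ := (Finset.mem_sdiff.1 hx).2
      refine ⟨x, hxL, fun hm => ?_, fun L' hL' hne hxL' => ?_⟩
      · rcases mem_unionLR_iff.1 hm with h | ⟨C, hC, hxC⟩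
        · exact hxP h
        · have hCA := (Finset.mem_filter.1 (Finset.mem_toList.1 hC)).1
          have hne : L ≠ C := fun h => (Finset.mem_filter.1 (Finset.mem_toList.1 hC)).2 (h ▸ hLt.2)
          exact hxv (Finset.card_le_one.1 (hApair L hLt.1 C hCA hne) x (Finset.mem_inter.2 ⟨hxL, hxC⟩) v
            (Finset.mem_inter.2 ⟨hLA.2, (hAmem C hCA).2⟩))
      · have hL'A := (Finset.mem_filter.1 (Finset.mem_toList.1 hL')).1
        exact hxv (Finset.card_le_one.1 (hApair L hLt.1 L' hL'A hne.symm) x (Finset.mem_inter.2 ⟨hxL, hxL'⟩) v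
          (Finset.mem_inter.2 ⟨hLA.2, (hAmem L' hL'A).2⟩))
    have hfree_a : freeCountR P₀ a = A.card := by
      rw [ha, freeCountR_append, hfreec, hfreet, Finset.length_toList, Finset.length_toList, Nat.add_comm]
      exact Finset.card_filter_add_card_filter_not (s := A) (fun L => (L ∩ P₀).card ≤ 1)
    have hstar := hk a hand (fun L hL => (hAmem L ((hamem L).1 hL)).1)
    rw [hfree_a] at hstar
    have hUnion : unionLR P₀ a \ P₀ = (A.biUnion id) \ P₀ := by
      ext u
      simp only [Finset.mem_sdiff, mem_unionLR_iff, Finset.mem_biUnion, id_eq, hamem]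
      tauto
    rw [hUnion] at hstar
    have hstarfat := sum_fat_sdiff_star_le w P₀ hvP A ⟨L₀, hL₀A⟩ (fun L hL => (hAmem L hL).2) hApair
    have hA1 : 1 ≤ A.card := Finset.card_pos.2 ⟨L₀, hL₀A⟩
    rw [← he] at hstarfat
    have hvfat : e ≤ fat w ((A.biUnion id) \ P₀) := by
      rw [he]
      split_ifs with h2
      · exact one_le_fat (Finset.mem_sdiff.2 ⟨Finset.mem_biUnion.2 ⟨L₀, hL₀A, hvL⟩, hvP⟩) h2
      · exact Nat.zero_le _
    -- the lines avoiding `v`: budget `b − 1 − e`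
    set B := T.filter (fun L => ¬ v ∈ L) with hB
    have hBk : ∀ l : List (Finset β), l.Nodup → (∀ L ∈ l, L ∈ B) →
        freeCountR P₀ l + fat w (unionLR P₀ l \ P₀) + 1 + e ≤ b := by
      intro l hnd hl
      have hvl : ∀ L ∈ l, v ∉ L := fun L hL => (Finset.mem_filter.1 (hl L hL)).2
      have hnot : L₀ ∉ l := fun h => hvl L₀ h hvL
      have h := hk (L₀ :: l) (List.nodup_cons.2 ⟨hnot, hnd⟩)
        (fun L hL => by
          rcases List.mem_cons.1 hL with rfl | hL
          · exact hL₀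
          · exact (Finset.mem_filter.1 (hl L hL)).1)
      rw [freeCountR_cons_of_new hvL hvP hvl] at h
      have hvU : v ∉ unionLR P₀ l \ P₀ := fun hm => by
        rcases mem_unionLR_iff.1 (Finset.mem_sdiff.1 hm).1 with h' | ⟨L, hL, hvL'⟩
        · exact hvP h'
        · exact hvl L hL hvL'
      have hsub : insert v (unionLR P₀ l \ P₀) ⊆ unionLR P₀ (L₀ :: l) \ P₀ := by
        intro u hu
        rcases Finset.mem_insert.1 hu with rfl | hu
        · exact Finset.mem_sdiff.2 ⟨mem_unionLR_of_mem List.mem_cons_self hvL, hvP⟩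
        · have hu' := Finset.mem_sdiff.1 hu
          refine Finset.mem_sdiff.2 ⟨?_, hu'.2⟩
          simp only [unionLR]
          exact Finset.mem_union_right _ hu'.1
      have hmono : fat w (insert v (unionLR P₀ l \ P₀)) ≤ fat w (unionLR P₀ (L₀ :: l) \ P₀) := by
        unfold fat
        exact Finset.card_le_card (Finset.filter_subset_filter _ hsub)
      rw [fat_insert_of_notMem w hvU, ← he] at hmono
      omega
    have ih := two_mul_sum_newFat_le' w P₀ n (b - 1 - e) (by omega) B
      (fun L hL => hT L (Finset.mem_filter.1 hL).1)
      (fun L hL L' hL' hne => hpair L (Finset.mem_filter.1 hL).1 L' (Finset.mem_filter.1 hL').1 hne)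
      (fun u hu L hL L' hL' => hone u hu L (Finset.mem_filter.1 hL).1 L' (Finset.mem_filter.1 hL').1)
      (fun l hnd hl => by have := hBk l hnd hl; omega)
    have hsplit := Finset.sum_filter_add_sum_filter_not T (fun L => v ∈ L) (fun L => 1 + fat w (L \ P₀))
    rw [← hA, ← hB] at hsplit
    rw [← hsplit, Finset.sum_add_distrib, Finset.sum_const_nat (m := 1) (fun _ _ => rfl), Nat.mul_one]
    have hd : A.card + e ≤ b := by omega
    clear hk hBk hsplit hUnion hAmem hApair hamem hand hfreec hfreet hfree_a
    rcases (by omega : e = 0 ∨ e = 1) with he0 | he1'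
    · rw [he0] at hd hstarfat ih
      obtain ⟨m, rfl⟩ : ∃ m, b = m + 1 := ⟨n, hbe⟩
      have key : (m + 1) * (m + 1 + 1) = (m + 1 - 1 - 0) * (m + 1 - 1 - 0 + 1) + 2 * (m + 1) := by
        simp only [Nat.add_sub_cancel, Nat.sub_zero]; ring
      omega
    · rw [he1'] at hd hstarfat ih hvfat
      have hb2 : 2 ≤ b := by omega
      obtain ⟨m, rfl⟩ : ∃ m, b = m + 1 + 1 := ⟨b - 2, by omega⟩
      have key : (m + 1 + 1) * (m + 1 + 1 + 1) = (m + 1 + 1 - 1 - 1) * (m + 1 + 1 - 1 - 1 + 1) + 4 * m + 6 := by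
        simp only [Nat.add_sub_cancel]; ring
      omega

/-- A point of `P₀` lies on at most `b` lines of a family with chords (each line has its own point off `P₀`). -/
theorem deg_mem_P₀_le' (w : β → ℕ) (P₀ : Finset β) (T : Finset (Finset β)) {b : ℕ} (p : β) (hp : p ∈ P₀)
    (hT : ∀ L ∈ T, L.card = 3 ∧ (L ∩ P₀).card ≤ 2)
    (hpair : ∀ L ∈ T, ∀ L' ∈ T, L ≠ L' → (L ∩ L').card ≤ 1)
    (hk : ∀ l : List (Finset β), l.Nodup → (∀ L ∈ l, L ∈ T) →
      freeCountR P₀ l + fat w (unionLR P₀ l \ P₀) ≤ b) :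
    (T.filter (fun L => p ∈ L)).card ≤ b := by
  set D := T.filter (fun L => p ∈ L) with hD
  have hmem : ∀ L ∈ D.toList, L ∈ T ∧ p ∈ L := fun L hL => Finset.mem_filter.1 (Finset.mem_toList.1 hL)
  have h := hk D.toList (Finset.nodup_toList D) (fun L hL => (hmem L hL).1)
  rw [freeCountR_eq_length_of_off P₀ D.toList (Finset.nodup_toList D) (fun L hL => by
    have hsd : 0 < (L \ P₀).card := by
      have := Finset.card_sdiff_add_card_inter L P₀
      have := (hT L (hmem L hL).1).1
      have := (hT L (hmem L hL).1).2
      omega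
    obtain ⟨x, hx⟩ := Finset.card_pos.1 hsd
    refine ⟨x, (Finset.mem_sdiff.1 hx).1, (Finset.mem_sdiff.1 hx).2, fun L' hL' hne hxL' => ?_⟩
    have hint := hpair L (hmem L hL).1 L' (hmem L' hL').1 hne.symm
    have hxp : x = p := Finset.card_le_one.1 hint x (Finset.mem_inter.2 ⟨(Finset.mem_sdiff.1 hx).1, hxL'⟩) p
      (Finset.mem_inter.2 ⟨(hmem L hL).2, (hmem L' hL').2⟩)
    rw [hxp] at hx
    exact (Finset.mem_sdiff.1 hx).2 hp), Finset.length_toList] at h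
  omega

/-- **The cap of a family with chords**: `2 · Σ_{L ∈ T} cap L ≤ b (b + 1) + 2 · fat P₀ · b`. -/
theorem two_mul_sum_cap_chord_le (w : β → ℕ) (P₀ : Finset β) (T : Finset (Finset β)) {b : ℕ}
    (hT : ∀ L ∈ T, L.card = 3 ∧ (L ∩ P₀).card ≤ 2)
    (hpair : ∀ L ∈ T, ∀ L' ∈ T, L ≠ L' → (L ∩ L').card ≤ 1)
    (hone : ∀ v, v ∉ P₀ → ∀ L ∈ T, ∀ L' ∈ T, v ∈ L → v ∈ L' → (L ∩ P₀).card = 2 → (L' ∩ P₀).card = 2 → L = L')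
    (hw : ∀ L ∈ T, ∀ v ∈ L, w v = 1 ∨ w v = 2) (hw5 : ∀ L ∈ T, wsum w L ≤ 5)
    (hk : ∀ l : List (Finset β), l.Nodup → (∀ L ∈ l, L ∈ T) →
      freeCountR P₀ l + fat w (unionLR P₀ l \ P₀) ≤ b) :
    2 * ∑ L ∈ T, capPaper L.card (fat w L) ≤ b * (b + 1) + 2 * (fat w P₀ * b) := by
  have hcap : ∀ L ∈ T, capPaper L.card (fat w L) = (1 + fat w (L \ P₀)) + fat w (L ∩ P₀) := by
    intro L hL
    have h1 := wsum_eq_card_add_fat w L (hw L hL)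
    have h2 := hw5 L hL
    have h3 := (hT L hL).1
    rw [h3, capPaper_three_eq' (by omega), fat_eq_fat_sdiff_add_fat_inter w L P₀]
    ring
  rw [Finset.sum_congr rfl hcap, Finset.sum_add_distrib]
  have h1 := two_mul_sum_newFat_le' w P₀ b b le_rfl T hT hpair hone hk
  -- the fat points of `P₀`
  have hline : ∀ L ∈ T, fat w (L ∩ P₀) = ∑ p ∈ P₀.filter (fun u => w u = 2), if p ∈ L then 1 else 0 := by
    intro L _
    unfold fat
    have e : (L ∩ P₀).filter (fun u => w u = 2) = (P₀.filter (fun u => w u = 2)).filter (fun p => p ∈ L) := by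
      ext u
      simp only [Finset.mem_filter, Finset.mem_inter]
      tauto
    rw [e, Finset.card_filter]
  have h2 : ∑ L ∈ T, fat w (L ∩ P₀) ≤ fat w P₀ * b := by
    rw [Finset.sum_congr rfl hline, Finset.sum_comm]
    have hdeg : ∀ p ∈ P₀.filter (fun u => w u = 2), (∑ L ∈ T, if p ∈ L then 1 else 0) ≤ b := by
      intro p hp
      rw [← Finset.card_filter]
      exact deg_mem_P₀_le' w P₀ T p (Finset.mem_filter.1 hp).1 hT hpair hk
    refine (Finset.sum_le_sum hdeg).trans ?_
    rw [Finset.sum_const_nat (m := b) (fun _ _ => rfl)]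
    rfl
  omega

end Seven

end FourCap

end S1

end PercRepro
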